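import Literature.MathematicalPhysics.QuantumLattice.HubbardLiebTwoHoppingsCore
import Literature.MathematicalPhysics.QuantumLattice.HubbardRingPerronFrobeniusProofs
import Literature.MathematicalPhysics.QuantumLattice.HubbardModelProofs
import HarnessLib

/-!
# Lieb's Theorem 2 for a Hubbard model with two hopping constants — III. sector language;
# the half-filled ground state of the breathing (plaquette) torus is unique

Trunk T-QLATTICE, family `hubbard`; sequel of `HubbardLiebTwoHoppings`, `HubbardLiebTwoHoppingsCore`.
In sector language (`LiebTwoHoppings.szSector_groundStates_smul₂`): for `X`, `Y` edge-disjoint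
with connected union and equinumerous bipartition, `a, b ≠ 0`, `U > 0`, any two ground states of
`H₂ = hamiltonian X a U + hamiltonian Y b 0` in the joint sector `(2n, S^z = 0)`
(`IsGroundStateInSector`) are proportional — the `2n`-particle ground energy is attained at
`S^z = 0` (`groundEnergy₂_eq_minEnergyOn_szSector`) and the ground eigenspace is a line.

Applied to the breathing / plaquette torus of Tsai–Kivelson (`breathing_halfFilled_groundStates_smul`,
`breathing_parent_groundStates_smul`): for EVEN `L`, intra-plaquette hopping `a ≠ 0`,
inter-plaquette hopping `b ≠ 0` and `U > 0`, the half-filled `(L², 0)` ground state of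
`H_L(a,b,U) = hamiltonian (G ∖ P) a U + hamiltonian (G ⊓ P) b 0` (`G` the torus graph, `P` =
"different `2 × 2` plaquette `{2m,2m+1}²`", as in `PlaquetteBreathingSelfDuality`) is unique up to
a scalar — the two bond graphs are edge-disjoint with union the connected bipartite torus graph
(`LiebTwoHoppings.fermionTorusGraph_connected`, `torusStagger_eq_neg_of_adj_holds`,
`LiebTwoHoppings.two_mul_card_filter_torusStagger_eq_one`; the connectivity of the torus graph and
the sublattice count are re-homed here from Summits-side theorem files, where Literature cannot
import them). Written for the crux `CooperPairDMott` of route `CooperPairDMottWalk` (summit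
`HubbardSuperconductivity`): the hypothesis "for every half-filled ground state `φ₀`" of its clause
(c) ranges over ONE ray for every `b > 0`.

Sources: E. H. Lieb, Phys. Rev. Lett. 62 (1989) 1201, Theorem 2 [LiebPRL1989]; W.-F. Tsai,
S. A. Kivelson, Phys. Rev. B 73 (2006) 214510 (plaquette Hubbard model); S. Friedli, Y. Velenik
(2017) §3.1 (torus). No definition and no named fact is introduced; everything is proved.
-/

noncomputable section

namespace Literature.MathematicalPhysics.QuantumLattice

open Matrix Finset
open scoped ComplexOrder

namespace LiebTwoHoppings

/-! ### Connectivity of the torus graphs; the two sublattices of the even torus -/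

section Torus

open Literature.Probability.LatticeModels

-- adapted from Summits/HubbardSuperconductivity/HubbardSuperconductivity/Theorems/
--   BalabanIRBirEveryGroundStateStubLiebAnchor.lean (same statements, Summits-side namespace)
/-- On the discrete torus `(ℤ/Lℤ)^d` every multiple `y + n eᵢ` of a unit jump is reachable from
`y` in `torusGraph d L`. Friedli–Velenik (2017) §3.1. [folklore] -/
theorem torusGraph_reachable_add_single {d L : ℕ} (y : TorusSite d L) (i : Fin d) :
    ∀ n : ℕ, (torusGraph d L).Reachable y (y + Pi.single i (n : ZMod L))
  | 0 => by rw [Nat.cast_zero, Pi.single_zero, add_zero]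
  | n + 1 => by
      refine (torusGraph_reachable_add_single y i n).trans ?_
      have hz : y + Pi.single i ((n + 1 : ℕ) : ZMod L) =
          (y + Pi.single i (n : ZMod L)) + Pi.single i 1 := by
        rw [Nat.cast_succ, Pi.single_add, add_assoc]
      rw [hz]
      by_cases h : y + Pi.single i (n : ZMod L) = (y + Pi.single i (n : ZMod L)) + Pi.single i 1
      · exact h ▸ SimpleGraph.Reachable.refl _
      · exact SimpleGraph.Adj.reachable ((torusGraph_adj_iff _ _).2 ⟨h, Or.inl ⟨i, rfl⟩⟩)

/-- Every site of the torus graph `(ℤ/Lℤ)^d` (`L ≠ 0`) is reachable from `0` (coordinate by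
coordinate along unit jumps). Friedli–Velenik (2017) §3.1. [folklore] -/
theorem torusGraph_reachable_zero {d L : ℕ} [NeZero L] (x : TorusSite d L) :
    (torusGraph d L).Reachable 0 x := by
  have key : ∀ s : Finset (Fin d),
      (torusGraph d L).Reachable 0 (∑ i ∈ s, (Pi.single i (x i) : TorusSite d L)) := by
    intro s
    induction s using Finset.induction_on with
    | empty => rw [Finset.sum_empty]
    | insert a s ha ih =>
        rw [Finset.sum_insert ha, add_comm]
        refine ih.trans ?_
        have h := torusGraph_reachable_add_single (∑ i ∈ s, (Pi.single i (x i) : TorusSite d L))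
          a (x a).val
        rwa [ZMod.natCast_zmod_val] at h
  have hx : x = ∑ i, (Pi.single i (x i) : TorusSite d L) := (Finset.univ_sum_single x).symm
  rw [hx]
  exact key Finset.univ

/-- **The fermionic torus graph is connected** (`L ≠ 0`): pull-back of the connected torus graph
along the bijection `FermionTorus.equivTorusSite`. Friedli–Velenik (2017) §3.1; Lieb, PRL 62 (1989)
1201 (connectivity hypothesis). [folklore] -/
theorem fermionTorusGraph_connected (d L : ℕ) [NeZero L] : (fermionTorusGraph d L).Connected :=
  (SimpleGraph.Iso.comap (FermionTorus.equivTorusSite (d := d) (L := L))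
    (torusGraph d L)).connected_iff.2
      ((SimpleGraph.connected_iff_exists_forall_reachable _).2 ⟨0, torusGraph_reachable_zero⟩)

-- adapted from Summits/HubbardSuperconductivity/HubbardSuperconductivity/Theorems/
--   JosephsonMirrorJmCuspHalfFilledSimple.lean (same statement, Summits-side namespace)
/-- **The two sublattices of the even torus are equinumerous**: for even `L` the staggering sign
`ε_x = (-1)^{x₁+x₂}` takes the value `+1` on exactly `L²/2` sites (the unit shift in the first
coordinate is a sign-flipping injection). Lieb, PRL 62 (1989) 1201 (`|A| = |B|`). [folklore] -/
theorem two_mul_card_filter_torusStagger_eq_one {L : ℕ} [NeZero L] (hL : Even L) :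
    2 * (univ.filter fun x : FermionTorus 2 L => torusStagger x = 1).card = L ^ 2 := by
  set A : Finset (FermionTorus 2 L) := univ.filter fun x : FermionTorus 2 L => torusStagger x = 1 with hA
  set s : FermionTorus 2 L → FermionTorus 2 L := fun x =>
    FermionTorus.ofTorusSite (FermionTorus.toTorusSite x + Pi.single (0 : Fin 2) 1) with hs
  have hts : ∀ x, FermionTorus.toTorusSite (s x) =
      FermionTorus.toTorusSite x + Pi.single (0 : Fin 2) 1 :=
    fun x => FermionTorus.toTorusSite_ofTorusSite _
  have hs_inj : Function.Injective s := by
    intro x y h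
    have h' := congrArg FermionTorus.toTorusSite h
    rw [hts, hts, add_left_inj] at h'
    exact (FermionTorus.equivTorusSite (d := 2) (L := L)).injective h'
  have hflip : ∀ x, torusStagger (s x) = -torusStagger x := fun x =>
    torusStagger_eq_neg_of_toTorusSite_eq hL (hts x)
  have hmemA : ∀ x, x ∈ A ↔ torusStagger x = 1 := fun x => by
    rw [hA, mem_filter]
    exact ⟨fun h => h.2, fun h => ⟨mem_univ _, h⟩⟩
  have h1 : A.map ⟨s, hs_inj⟩ ⊆ Aᶜ := by
    intro y hy
    rw [mem_map] at hy
    obtain ⟨x, hx, rfl⟩ := hy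
    rw [mem_compl, hmemA]
    rw [hmemA] at hx
    change torusStagger (s x) ≠ 1
    rw [hflip, hx]
    exact Int.units_ne_iff_eq_neg.2 rfl
  have h2 : Aᶜ.map ⟨s, hs_inj⟩ ⊆ A := by
    intro y hy
    rw [mem_map] at hy
    obtain ⟨x, hx, rfl⟩ := hy
    rw [mem_compl, hmemA] at hx
    rw [hmemA]
    change torusStagger (s x) = 1
    rw [hflip, Int.units_ne_iff_eq_neg.1 hx, neg_neg]
  have c1 : A.card ≤ Aᶜ.card := by simpa using card_le_card h1
  have c2 : Aᶜ.card ≤ A.card := by simpa using card_le_card h2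
  have hsum : A.card + Aᶜ.card = L ^ 2 := by
    rw [card_add_card_compl]
    simp [FermionTorus, Fintype.card_lex]
  omega

end Torus

/-! ### The joint sector `(2n, S^z = 0)` for `H₂` -/

section Sector

open LiebThm1 LiebTwo

variable {Λ : Type*} [LinearOrder Λ] [Fintype Λ]
  (X Y : SimpleGraph Λ) [DecidableRel X.Adj] [DecidableRel Y.Adj]

/-- **Ground states of `H₂` exist in the sector `(2n, 0)`** (`n ≤ |Λ|`), and the sector energy
bounds `H₂` from below on the `(n, n)` sector (the tree's `szSector_groundState`, for the
sector-preserving Hermitian `H₂`). [folklore] -/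
theorem szSector_groundState₂ (a b U : ℝ) {n : ℕ} (hn : n ≤ Fintype.card Λ) :
    (∃ ψ, IsGroundStateInSector (hamiltonian X a U + hamiltonian Y b 0) (2 * n) 0 ψ) ∧
      ∀ φ : Fock (Orb Λ), IsInSector n n φ →
        (hamiltonian X a U + hamiltonian Y b 0).minEnergyOn (szSector (2 * n) 0) * (star φ ⬝ᵥ φ).re ≤
          (expect (hamiltonian X a U + hamiltonian Y b 0) φ).re := by
  classical
  obtain ⟨α₀, -, hα₀⟩ : ∃ α₀ : Finset Λ, α₀ ⊆ univ ∧ α₀.card = n :=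
    Finset.exists_subset_card_eq (by rwa [Finset.card_univ])
  have hp : ∃ s : Finset (Orb Λ), (upPart s).card = n ∧ (downPart s).card = n :=
    ⟨pairSet α₀ α₀, by rw [upPart_pairSet, hα₀], by rw [downPart_pairSet, hα₀]⟩
  have hinv : ∀ s s' : Finset (Orb Λ), ¬((upPart s).card = n ∧ (downPart s).card = n) →
      ((upPart s').card = n ∧ (downPart s').card = n) →
        (hamiltonian X a U + hamiltonian Y b 0) s s' = 0 := by
    intro s s' hs hs'
    by_contra h
    have := preservesSectors_hamiltonian₂ X Y a b U s s' h
    exact hs ⟨this.1.trans hs'.1, this.2.trans hs'.2⟩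
  have hK : ∀ v : Fock (Orb Λ), v ∈ szSector (2 * n) (0 : ℝ) ↔
      ∀ s, ¬((upPart s).card = n ∧ (downPart s).card = n) → v s = 0 :=
    fun v => mem_szSector_two_mul_zero_iff n v
  obtain ⟨⟨v, hv, hv0, hHv⟩, hbd⟩ := Literature.MathematicalPhysics.QuantumLattice.sector_groundState
    (hamiltonian X a U + hamiltonian Y b 0) (hamiltonian₂_isHermitian X Y a b U)
    (fun s => (upPart s).card = n ∧ (downPart s).card = n) hp hinv (szSector (2 * n) 0) hK
  exact ⟨⟨v, hv, hv0, hHv⟩, fun φ hφ => mul_norm_le_of_unit_bound _ hbd hφ⟩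

/-- **For `H₂` on a connected bipartite pair with equinumerous colour classes, the half-filled
ground-state energy is attained in the `S^z = 0` sector**: `E₀(2n) = min E on (2n, S^z = 0)`
(the ground eigenspace is a spin multiplet — here a singlet — and contains a nonzero `S^z = 0`
vector, `lieb_repulsive_halfFilling_core₂`). [cite: LiebPRL1989, Theorem 2] -/
theorem groundEnergy₂_eq_minEnergyOn_szSector (hG : (X ⊔ Y).Connected)
    (hXY : ∀ x y, X.Adj x y → ¬ Y.Adj x y) (A : Finset Λ)
    (hAX : ∀ x y : Λ, X.Adj x y → (x ∈ A ↔ y ∉ A)) (hAY : ∀ x y : Λ, Y.Adj x y → (x ∈ A ↔ y ∉ A))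
    {n : ℕ} (hΛ : Fintype.card Λ = 2 * n) {J : ℕ} (hAJ : A.card + J = n)
    {a b U : ℝ} (ha : a ≠ 0) (hb : b ≠ 0) (hU : 0 < U) :
    groundEnergy (hamiltonian X a U + hamiltonian Y b 0) (2 * n) =
      (hamiltonian X a U + hamiltonian Y b 0).minEnergyOn (szSector (2 * n) 0) := by
  classical
  set H := hamiltonian X a U + hamiltonian Y b 0 with hH
  set E₀ : ℝ := groundEnergy H (2 * n) with hE₀
  set E₁ : ℝ := H.minEnergyOn (szSector (2 * n) 0) with hE₁
  have hn : n ≤ Fintype.card Λ := by omega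
  obtain ⟨-, hbd⟩ := szSector_groundState₂ X Y a b U hn
  obtain ⟨-, -, ψ₀, hψ₀V, hψ₀ne, hψ₀Z⟩ :=
    lieb_repulsive_halfFilling_core₂ X Y hG hXY A hAX hAY hΛ hAJ ha hb hU
  obtain ⟨hHψ₀, hNψ₀⟩ := (mem_groundSector_iff' H (2 * n) E₀ ψ₀).1 hψ₀V
  have hψ₀sz : ψ₀ ∈ szSector (2 * n) (0 : ℝ) := by
    rw [mem_szSector_iff]
    exact ⟨hNψ₀, by rw [hψ₀Z, Complex.ofReal_zero, zero_smul]⟩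
  -- `E₀ ≤ E₁`: the sector Rayleigh set is contained in the `N`-particle one
  have hle : E₀ ≤ E₁ := by
    rw [hE₀, Literature.MathematicalPhysics.QuantumLattice.groundEnergy, hE₁, Matrix.minEnergyOn]
    refine csInf_le_csInf (bddBelow_energySet H (2 * n)) ?_ ?_
    · obtain ⟨c, -, hc1⟩ := Literature.MathematicalPhysics.QuantumLattice.exists_smul_unit hψ₀ne
      exact ⟨_, c • ψ₀, Submodule.smul_mem _ c hψ₀sz, hc1, rfl⟩
    · rintro E ⟨φ, hφ, hφ1, rfl⟩
      exact ⟨φ, ((mem_szSector_iff _ _ _).1 hφ).1, hφ1, rfl⟩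
  -- `E₁ ≤ E₀`: the weight-zero ground state is a competitor in the sector
  have hge : E₁ ≤ E₀ := by
    have h1 := hbd ψ₀ ((mem_szSector_two_mul_zero_iff n ψ₀).1 hψ₀sz)
    rw [Literature.MathematicalPhysics.QuantumLattice.expect, hHψ₀, dotProduct_smul, smul_eq_mul,
      Complex.re_ofReal_mul] at h1
    have hpos : 0 < (star ψ₀ ⬝ᵥ ψ₀).re :=
      (Complex.pos_iff.1 (dotProduct_star_self_pos_iff.2 hψ₀ne)).1
    exact le_of_mul_le_mul_right h1 hpos
  exact le_antisymm hle hge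

/-- **Lieb's Theorem 2 for `H₂` with equinumerous colour classes, in sector language.** For
`X`, `Y` edge-disjoint with connected union and common bipartition colour class `A`,
`|A| = |B| = n`, `a ≠ 0`, `b ≠ 0`, `U > 0`: any two ground states of
`H₂ = hamiltonian X a U + hamiltonian Y b 0` in the joint sector `(2n, S^z = 0)` are proportional
(the `2n`-particle ground eigenspace is one-dimensional, `2S + 1 = 1`, and contains the
`S^z = 0` floor). [cite: LiebPRL1989, Theorem 2] -/
theorem szSector_groundStates_smul₂ (hG : (X ⊔ Y).Connected)
    (hXY : ∀ x y, X.Adj x y → ¬ Y.Adj x y) (A : Finset Λ)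
    (hAX : ∀ x y : Λ, X.Adj x y → (x ∈ A ↔ y ∉ A)) (hAY : ∀ x y : Λ, Y.Adj x y → (x ∈ A ↔ y ∉ A))
    {n : ℕ} (hΛ : Fintype.card Λ = 2 * n) (hAn : A.card + 0 = n)
    {a b U : ℝ} (ha : a ≠ 0) (hb : b ≠ 0) (hU : 0 < U) (φ φ' : Fock (Orb Λ))
    (hφ : IsGroundStateInSector (hamiltonian X a U + hamiltonian Y b 0) (2 * n) 0 φ)
    (hφ' : IsGroundStateInSector (hamiltonian X a U + hamiltonian Y b 0) (2 * n) 0 φ') :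
    ∃ c : ℂ, φ' = c • φ := by
  set H := hamiltonian X a U + hamiltonian Y b 0 with hH
  obtain ⟨hrank, -⟩ := lieb_repulsive_halfFilling_core₂ X Y hG hXY A hAX hAY hΛ hAn ha hb hU
  have hE : H.minEnergyOn (szSector (Λ := Λ) (2 * n) 0) = groundEnergy H (2 * n) :=
    (groundEnergy₂_eq_minEnergyOn_szSector X Y hG hXY A hAX hAY hΛ hAn ha hb hU).symm
  have hmem : ∀ ψ : Fock (Orb Λ), IsGroundStateInSector H (2 * n) 0 ψ →
      ψ ∈ LinearMap.ker (Matrix.toLin' (H - ((groundEnergy H (2 * n) : ℝ) : ℂ) • 1)) ⊓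
        LinearMap.ker (Matrix.toLin' (totalNumber - ((2 * n : ℕ) : ℂ) • (1 : Matrix _ _ ℂ))) := by
    intro ψ hψ
    refine (mem_groundSector_iff' H (2 * n) _ ψ).2 ⟨?_, ((mem_szSector_iff _ _ _).1 hψ.1).1⟩
    have h := hψ.2.2
    rw [hE] at h
    exact h
  have hrank1 : Module.finrank ℂ ↥(LinearMap.ker (Matrix.toLin' (H -
          ((groundEnergy H (2 * n) : ℝ) : ℂ) • 1)) ⊓
        LinearMap.ker (Matrix.toLin' (totalNumber - ((2 * n : ℕ) : ℂ) • (1 : Matrix _ _ ℂ)))) = 1 := by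
    rw [hH]; omega
  have hφ0 : (⟨φ, hmem φ hφ⟩ : ↥(LinearMap.ker (Matrix.toLin' (H -
          ((groundEnergy H (2 * n) : ℝ) : ℂ) • 1)) ⊓
        LinearMap.ker (Matrix.toLin' (totalNumber - ((2 * n : ℕ) : ℂ) • (1 : Matrix _ _ ℂ))))) ≠ 0 :=
    fun h => hφ.2.1 (congrArg Subtype.val h)
  obtain ⟨c, hc⟩ := (finrank_eq_one_iff_of_nonzero' _ hφ0).1 hrank1 ⟨φ', hmem φ' hφ'⟩
  exact ⟨c, (congrArg Subtype.val hc).symm⟩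

end Sector

end LiebTwoHoppings

/-! ### The breathing torus: the half-filled ground state is unique (Lieb) -/

section Breathing

open Matrix Finset
open Literature.Probability.LatticeModels

/-- The "different plaquette" relation `P` on the fermionic torus, as in the route statement. -/
local notation "Pq[" L "]" =>
  (SimpleGraph.comap (fun (x : FermionTorus 2 L) (i : Fin 2) => (ofLex x i : ℕ) / 2)
    (⊤ : SimpleGraph (Fin 2 → ℕ)))

/-- The breathing Hamiltonian `H_L(a, b, U)`, verbatim the route's `Hb L a b U`. -/
local notation "Hb[" L "," a "," b "," U "]" =>
  (hamiltonian (fermionTorusGraph 2 L \ Pq[L]) a U + hamiltonian (fermionTorusGraph 2 L ⊓ Pq[L]) b 0)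

variable {L : ℕ} [NeZero L]

/-- **The half-filled ground state of the breathing torus is unique (Lieb's Theorem 2).** For even
`L`, hoppings `a ≠ 0` (intra-plaquette) and `b ≠ 0` (inter-plaquette) and repulsion `U > 0`, any
two ground states of `H_L(a,b,U)` in the joint sector `(L², S^z = 0)` are proportional: the intra-
and inter-plaquette bond graphs are edge-disjoint with union the connected bipartite torus graph
(`LiebTwoHoppings.fermionTorusGraph_connected`, `torusStagger_eq_neg_of_adj_holds`) whose
sublattices are equinumerous (`LiebTwoHoppings.two_mul_card_filter_torusStagger_eq_one`), so Lieb's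
theorem for two hopping constants (`LiebTwoHoppings.szSector_groundStates_smul₂`) applies with `S = 0`. In particular the
hypothesis "`∀ φ₀`" of clause (c) of `CooperPairDMott` ranges over ONE ray for every `b > 0`.
[cite: LiebPRL1989, Theorem 2] -/
theorem breathing_halfFilled_groundStates_smul (hL : Even L) {a b U : ℝ} (ha : a ≠ 0) (hb : b ≠ 0)
    (hU : 0 < U) (φ φ' : Fock (Orb (FermionTorus 2 L)))
    (hφ : IsGroundStateInSector Hb[L,a,b,U] (L ^ 2) 0 φ)
    (hφ' : IsGroundStateInSector Hb[L,a,b,U] (L ^ 2) 0 φ') : ∃ c : ℂ, φ' = c • φ := by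
  obtain ⟨m, hm⟩ := hL
  set n : ℕ := 2 * m ^ 2 with hn
  have h2n : L ^ 2 = 2 * n := by rw [hn, hm]; ring
  rw [h2n] at hφ hφ'
  have hcard : Fintype.card (FermionTorus 2 L) = 2 * n := by
    rw [hn, hm]
    simp only [FermionTorus, Fintype.card_lex, Fintype.card_fun, Fintype.card_fin]
    ring
  -- the two bond graphs: edge-disjoint, union = the torus graph
  have hsup : (fermionTorusGraph 2 L \ Pq[L]) ⊔ (fermionTorusGraph 2 L ⊓ Pq[L]) = fermionTorusGraph 2 L := by
    rw [sup_comm, sup_inf_sdiff]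
  have hG : ((fermionTorusGraph 2 L \ Pq[L]) ⊔ (fermionTorusGraph 2 L ⊓ Pq[L])).Connected := by
    rw [hsup]
    exact LiebTwoHoppings.fermionTorusGraph_connected 2 L
  have hXY : ∀ x y, (fermionTorusGraph 2 L \ Pq[L]).Adj x y → ¬ (fermionTorusGraph 2 L ⊓ Pq[L]).Adj x y := by
    intro x y hX hY
    exact ((SimpleGraph.sdiff_adj _ _ _ _).1 hX).2 ((SimpleGraph.inf_adj _ _ _ _).1 hY).2
  -- the bipartition by the staggering sign
  set A : Finset (FermionTorus 2 L) := univ.filter fun x : FermionTorus 2 L => torusStagger x = 1 with hA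
  have hmemA : ∀ x, x ∈ A ↔ torusStagger x = 1 := fun x => by
    rw [hA, mem_filter]
    exact ⟨fun h => h.2, fun h => ⟨mem_univ _, h⟩⟩
  have hAadj : ∀ x y : FermionTorus 2 L, (fermionTorusGraph 2 L).Adj x y → (x ∈ A ↔ y ∉ A) := by
    intro x y hxy
    have h := torusStagger_eq_neg_of_adj_holds ⟨m, hm⟩ hxy
    rw [hmemA, hmemA, h]
    change -torusStagger y = 1 ↔ torusStagger y ≠ 1
    rw [Int.units_ne_iff_eq_neg, neg_eq_iff_eq_neg]
  have hAX : ∀ x y : FermionTorus 2 L, (fermionTorusGraph 2 L \ Pq[L]).Adj x y → (x ∈ A ↔ y ∉ A) :=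
    fun x y h => hAadj x y ((SimpleGraph.sdiff_adj _ _ _ _).1 h).1
  have hAY : ∀ x y : FermionTorus 2 L, (fermionTorusGraph 2 L ⊓ Pq[L]).Adj x y → (x ∈ A ↔ y ∉ A) :=
    fun x y h => hAadj x y ((SimpleGraph.inf_adj _ _ _ _).1 h).1
  have hAc : A.card + 0 = n := by
    have h := LiebTwoHoppings.two_mul_card_filter_torusStagger_eq_one (L := L) ⟨m, hm⟩
    rw [← hA] at h
    omega
  exact LiebTwoHoppings.szSector_groundStates_smul₂ _ _ hG hXY A hAX hAY hcard hAc ha hb hU φ φ' hφ hφ'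

/-- **Uniqueness of the d-Mott parent of the line** (the crux's breathing family `Hb L 1 b U`,
`L = 4k + 4`, any `b ≠ 0`, `U > 0`): the `((4k+4)², S^z = 0)` ground state is unique up to a
scalar (Lieb). [cite: LiebPRL1989, Theorem 2] -/
theorem breathing_parent_groundStates_smul :
    (let Hb := fun (L : ℕ) (a b U : ℝ) => hamiltonian (fermionTorusGraph 2 L \ (⊤ : SimpleGraph (Fin 2 → ℕ)).comap (fun (x : FermionTorus 2 L) (i : Fin 2) => (ofLex x i : ℕ) / 2)) a U + hamiltonian (fermionTorusGraph 2 L ⊓ (⊤ : SimpleGraph (Fin 2 → ℕ)).comap (fun (x : FermionTorus 2 L) (i : Fin 2) => (ofLex x i : ℕ) / 2)) b 0;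
    ∀ (k : ℕ) (b U : ℝ), b ≠ 0 → 0 < U →
      ∀ φ₁ φ₂, IsGroundStateInSector (Hb (4 * k + 4) 1 b U) ((4 * k + 4) ^ 2) 0 φ₁ →
        IsGroundStateInSector (Hb (4 * k + 4) 1 b U) ((4 * k + 4) ^ 2) 0 φ₂ → ∃ c : ℂ, φ₂ = c • φ₁) := by
  dsimp only
  intro k b U hb hU φ₁ φ₂ h₁ h₂
  exact breathing_halfFilled_groundStates_smul (L := 4 * k + 4) ⟨2 * k + 2, by ring⟩ one_ne_zero hb hU
    φ₁ φ₂ h₁ h₂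

end Breathing
end Literature.MathematicalPhysics.QuantumLattice

end
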